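import Mathlib
import Summits.Ventures.HodgeRepro2.T6NAut3
import Summits.Ventures.HodgeRepro2.T6N2Contract3
import Summits.Ventures.HodgeRepro2.T6N2RatForm
import Summits.Ventures.HodgeRepro2.T6N3Toy2V

/-!
# T6N2Rich — the N2 datum as a CONSTRUCTION from its admissible sets: the «rich datum» of the N2
block (owner t6-p5; the lead's rich-datum pattern of STATUS l. 11500 (1) for N5 / t6-p6's Bergman
pattern, applied to N2; count-neutral, carrier-free, nothing on the v6 line changes)

On the M2 v6 line (`periodInputN_of_published₆`, T6PeriodInput6 p407424) the N2 block costs FIVE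
residual binders: the explicit shape of the carrier's N2 datum `hfr h₁₁₁ hm he` (class EX, four
binders: TIER5 (N2-b) «THIS is the datum N0 states once») and the sentence N2 and N3 share,
`hAdm : M.d2.AdmGenerating` (class AD: the admissible Schwartz data of the four lines generate the
product modules). Both are THEOREMS once the datum is what the record says it is — a CONSTRUCTION
from the admissible sets alone: the CM frame comes from the face setting (`frameOf F.deg6`), `e₁₁₁`
and `u` by weak approximation (`e111Of`, `uOf`), `e₁₀₀ := u (1 − u) e₁₁₁`, the characters trivial,
and the admissible sets are the record's ℚ-RATIONAL SUBSPACES (STATUS l. 11271 (2), adopted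
l. 11316 (2), TARGET-T6 v0.7 §10 (viii)): ℚ-forms of the `K`-fixed Schwartz data, ℂ-SPANNING
(= `AdmSpanning`, hence `AdmGenerating`), not ℂ-closed. This file packages exactly the data a
Layer-III instantiation supplies — the four admissible sets with their ℂ-spanning — as
`N2Rich 𝒟`, builds the datum `N2Rich.toDatum F P : N2Datum F P 𝒟` (= `toyIsoSF` at those sets),
and proves on it, with NO hypothesis: `Adm` (N2's conclusion), `AdmSpanning` / `AdmGenerating`
(N3's sentence), the explicit shape (the four EX binders), and `AdmData` = membership. On the
carrier this gives the N2 block of a composition in ONE construction binder: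

* `N2_main_rich₃ (M : NAut3 F P) (R : N2Rich M.d3) (hR : M.d2 = R.toDatum F P) : M.AdmDatum`,
* `admGenerating_rich₃ M R hR : M.d2.AdmGenerating` (so `hAdm` is discharged too),
* `explicitShape_rich₃ M R hR : N2Contract3.ExplicitShape M`, `N2_block_rich₃ M R hR` (both at once).

CENSUS EFFECT (for the lead's hour only — l. 11500 (1)(c): a v7 is the lead's call AFTER the
§10.5(ii)(d) declaration on v6, on the criterion of a shrinking residual census): the N2 binders
`hfr h₁₁₁ hm he` [EX ×4] + `hAdm` [AD ×1] of v6 would be replaced by `(R2 : N2Rich M.d3)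
(hR2 : M.d2 = R2.toDatum F P)` [EX ×2, construction: the datum is what the record constructs] —
AD −1, EX −2; NOT a display, NOT a new statement of mathematics (every proof here is a v2/v3
theorem of T6N2ToyIso / T6N2ToyIsoS / T6N2RatForm applied to `toyIsoSF`). The declared M2 object
stays v6; this file is consumed by nothing on the v6 line.

INSTANCES (§10.5(ii)(c)/(d), so that a re-point of the joint toy is mechanical): `N2Rich.univ`
(admissible sets `Set.univ` — the pre-record toy; `toDatum = toyIsoF`), `N2Rich.ofBases bA bB bC bD`
(the ℚ-forms `ratSpan (range b)` of four ℂ-bases — `toDatum = N2RatForm.toyIsoQ`, the host-faithful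
shape: ℚ-closed, ℂ-spanning, not ℂ-closed), and `N2Rich.rat V v w` on t6-p3's `N3ToyV.toyVW V v w`
with the four sets `N3ToyV.ratSet` — `toDatum = toyIsoSF F P (toyVW V v w) ratSet ratSet ratSet
ratSet` by `rfl`, i.e. EXACTLY the `witN2` of t6-p3's (β) T6N3WitInstance / the `d2` of t6-p6's
(γ) T6PeriodInput6Toy2, so on the joint toy `hR2` is `rfl`.

README §8(d): uses an L-value-free non-vanishing device: NO (TIER5 §N2, a pre-02:16Z line of
record — N2 asserts no non-vanishing — continued).
-/

namespace Summit.Ventures.HodgeRepro2.T6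

open Summit.Ventures.HodgeRepro2
open Summit.Ventures.HodgeRepro2.T5DatumSimilitude
open Summit.Ventures.HodgeRepro2.T5CubeTypes
open Summit.Ventures.HodgeRepro2.T6.N2ToyIso
open Summit.Ventures.HodgeRepro2.T6.N2ToyIsoS

/-- THE N2 RICH DATUM over the N3 datum `𝒟`: the admissible Schwartz data of the four lines
(B7(b) / Lemma A7.3(b) — the record's ℚ-rational subspaces) as subsets of the N3 sides' Schwartz
spaces, each ℂ-SPANNING its line (the `AdmSpanning` clause, a property of a ℚ-form). Everything
else of the N2 datum is CONSTRUCTED from it (`toDatum`). Data + the construction's proof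
obligations only; no display, no conclusion of N2 is a field. -/
structure N2Rich (𝒟 : N3Datum) where
  /-- The admissible Schwartz data of the line `111` (side A, first factor). -/
  admA : Set 𝒟.A.Sa
  /-- The admissible Schwartz data of the line `100` (side A, second factor). -/
  admB : Set 𝒟.A.Sb
  /-- The admissible Schwartz data of the line `101` (side B, first factor). -/
  admC : Set 𝒟.B.Sa
  /-- The admissible Schwartz data of the line `110` (side B, second factor). -/
  admD : Set 𝒟.B.Sb
  /-- Line `111`: the admissible data ℂ-span the line's Schwartz space (a ℚ-form spans). -/
  spanA : Submodule.span ℂ admA = ⊤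
  /-- Line `100`: the admissible data ℂ-span the line's Schwartz space. -/
  spanB : Submodule.span ℂ admB = ⊤
  /-- Line `101`: the admissible data ℂ-span the line's Schwartz space. -/
  spanC : Submodule.span ℂ admC = ⊤
  /-- Line `110`: the admissible data ℂ-span the line's Schwartz space. -/
  spanD : Submodule.span ℂ admD = ⊤

namespace N2Rich

variable {K : Type*} [Field K] [NumberField K] [NumberField.IsCMField K]
variable {𝒟 : N3Datum} (R : N2Rich 𝒟) (F : FaceSetting K) (P : NDatum F)

/-! ### The constructed datum and its theorems (no hypothesis) -/

/-- THE N2 DATUM CONSTRUCTED FROM THE RICH DATUM: `toyIsoSF` (T6N2ToyIsoS) at the four admissible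
sets — the CM frame `frameOf F.deg6`, `e₁₁₁ := e111Of`, `u := uOf`, `e₁₀₀ := u (1 − u) e₁₁₁`,
`Char := Unit`, the admissible sets of `R`. -/
noncomputable def toDatum : N2Datum F P 𝒟 :=
  toyIsoSF F P 𝒟 R.admA R.admB R.admC R.admD

/-- The admissible set of line `111` of the constructed datum is `R.admA` (`rfl`). -/
theorem toDatum_admA : (R.toDatum F P).admA = R.admA := rfl

/-- The admissible set of line `100` of the constructed datum is `R.admB` (`rfl`). -/
theorem toDatum_admB : (R.toDatum F P).admB = R.admB := rfl

/-- The admissible set of line `101` of the constructed datum is `R.admC` (`rfl`). -/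
theorem toDatum_admC : (R.toDatum F P).admC = R.admC := rfl

/-- The admissible set of line `110` of the constructed datum is `R.admD` (`rfl`). -/
theorem toDatum_admD : (R.toDatum F P).admD = R.admD := rfl

/-- N2's CONCLUSION on the constructed datum, no hypothesis: μ-admissibility of the four `ε_i`,
the isometry `W_B ≅ W_A`, (H_χ) (T6N2ToyIsoS `toyIsoSF_adm`). -/
theorem toDatum_adm : (R.toDatum F P).Adm :=
  toyIsoSF_adm F P 𝒟 R.admA R.admB R.admC R.admD

/-- N3's STRONGER sentence `AdmSpanning` on the constructed datum: the four spanning fields. -/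
theorem toDatum_admSpanning : (R.toDatum F P).AdmSpanning :=
  ⟨R.spanA, R.spanB, R.spanC, R.spanD⟩

/-- THE SENTENCE N2 AND N3 SHARE, `AdmGenerating` (the binder `hAdm` of `N3iso_main₂` / `₃` and of
`periodInputN_of_published₆`), on the constructed datum with no hypothesis. -/
theorem toDatum_admGenerating : (R.toDatum F P).AdmGenerating :=
  (R.toDatum F P).admGenerating_of_admSpanning (R.toDatum_admSpanning F P)

/-- The four EX binders `hfr h₁₁₁ hm he` of `N2_main_explicit` hold on the constructed datum
(T6N2ToyIsoS `toyIsoSF_explicitShape`). -/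
theorem toDatum_explicitShape :
    IsCMFrame (R.toDatum F P).τ ∧
      IsLiuSignElement K ((R.toDatum F P).type t111) (R.toDatum F P).e₁₁₁ ∧
      MagSpec (R.toDatum F P).τ (R.toDatum F P).u ∧
      (R.toDatum F P).e₁₀₀ = (R.toDatum F P).u * (1 - (R.toDatum F P).u) * (R.toDatum F P).e₁₁₁ :=
  toyIsoSF_explicitShape F P 𝒟 R.admA R.admB R.admC R.admD

/-- `AdmData` of the constructed datum is membership in the four admissible sets (`Iff.rfl`). -/
theorem toDatum_admData_iff (φ : 𝒟.A.Sa × 𝒟.A.Sb × 𝒟.B.Sa × 𝒟.B.Sb) :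
    (R.toDatum F P).AdmData φ ↔
      φ.1 ∈ R.admA ∧ φ.2.1 ∈ R.admB ∧ φ.2.2.1 ∈ R.admC ∧ φ.2.2.2 ∈ R.admD :=
  Iff.rfl

/-! ### Instances: `univ`, ℚ-forms of bases, the ℚ-rational sets of the joint toy -/

/-- The rich datum with admissible sets `Set.univ` (the pre-record toy of T6N2ToyIso). -/
def univ (𝒟 : N3Datum) : N2Rich 𝒟 :=
  ⟨Set.univ, Set.univ, Set.univ, Set.univ, Submodule.span_univ, Submodule.span_univ,
    Submodule.span_univ, Submodule.span_univ⟩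

/-- At `univ` the constructed datum is T6N2ToyIso's `toyIsoF` (`rfl`). -/
theorem univ_toDatum : (univ 𝒟).toDatum F P = toyIsoF F P 𝒟 := rfl

/-- The rich datum of FOUR ℂ-BASES: the admissible sets are the ℚ-forms `ratSpan (range b)`
(T6N2RatForm — ℚ-closed, ℂ-spanning, not ℂ-closed: the host-faithful shape). -/
noncomputable def ofBases {ιA ιB ιC ιD : Type*} (bA : Module.Basis ιA ℂ 𝒟.A.Sa)
    (bB : Module.Basis ιB ℂ 𝒟.A.Sb) (bC : Module.Basis ιC ℂ 𝒟.B.Sa)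
    (bD : Module.Basis ιD ℂ 𝒟.B.Sb) : N2Rich 𝒟 :=
  ⟨N2RatForm.ratSpan (Set.range bA), N2RatForm.ratSpan (Set.range bB),
    N2RatForm.ratSpan (Set.range bC), N2RatForm.ratSpan (Set.range bD),
    N2RatForm.span_ratSpan_range_eq_top bA, N2RatForm.span_ratSpan_range_eq_top bB,
    N2RatForm.span_ratSpan_range_eq_top bC, N2RatForm.span_ratSpan_range_eq_top bD⟩

/-- At `ofBases` the constructed datum is T6N2RatForm's `toyIsoQ` (`rfl`). -/
theorem ofBases_toDatum {ιA ιB ιC ιD : Type*} (bA : Module.Basis ιA ℂ 𝒟.A.Sa)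
    (bB : Module.Basis ιB ℂ 𝒟.A.Sb) (bC : Module.Basis ιC ℂ 𝒟.B.Sa)
    (bD : Module.Basis ιD ℂ 𝒟.B.Sb) :
    (ofBases bA bB bC bD).toDatum F P = N2RatForm.toyIsoQ F P 𝒟 bA bB bC bD := rfl

/-- The rich datum of the JOINT TOY: on t6-p3's `N3ToyV.toyVW V v w` (Schwartz spaces `ℂ`) the four
admissible sets are `N3ToyV.ratSet = Set.range ((↑) : ℚ → ℂ)` (ℂ-spanning by `span_ratSet`). -/
noncomputable def rat (V : Type) [NormedAddCommGroup V] [InnerProductSpace ℂ V]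
    [CompleteSpace V] (v w : V) : N2Rich (N3ToyV.toyVW V v w) :=
  ⟨N3ToyV.ratSet, N3ToyV.ratSet, N3ToyV.ratSet, N3ToyV.ratSet, N3ToyV.span_ratSet,
    N3ToyV.span_ratSet, N3ToyV.span_ratSet, N3ToyV.span_ratSet⟩

/-- At `rat` the constructed datum is EXACTLY the joint toy's N2 datum `toyIsoSF F P (toyVW V v w)
ratSet ratSet ratSet ratSet` (= t6-p3's `witN2` / the `d2` of t6-p6's T6PeriodInput6Toy2) — `rfl`,
so on the joint toy the construction binder `hR2` is `rfl`. -/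
theorem rat_toDatum (V : Type) [NormedAddCommGroup V] [InnerProductSpace ℂ V] [CompleteSpace V]
    (v w : V) :
    (rat V v w).toDatum F P =
      toyIsoSF F P (N3ToyV.toyVW V v w) N3ToyV.ratSet N3ToyV.ratSet N3ToyV.ratSet N3ToyV.ratSet :=
  rfl

/-! ### The N2 block of a composition in ONE construction binder, on the carrier `NAut3` -/

variable {F P}

/-- `N2_main` IN THE RICH FORM (the N2 block of a v7 composition, TARGET-T6 §9.3 shape): on the
re-cut carrier `M`, if its N2 datum IS the datum constructed from a rich datum `R` (the one
construction binder `hR`, class EX), then `M.AdmDatum` — no display, no explicit-shape binders. -/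
theorem N2_main_rich₃ (M : NAut3 F P) (R : N2Rich M.d3) (hR : M.d2 = R.toDatum F P) :
    M.AdmDatum := by
  show M.d2.Adm
  rw [hR]
  exact R.toDatum_adm F P

/-- THE SENTENCE N2 AND N3 SHARE, discharged by the same construction binder: `hAdm` of
`periodInputN_of_published₆` (class AD on v6) is a theorem on a carrier whose N2 datum is
constructed from a rich datum. -/
theorem admGenerating_rich₃ (M : NAut3 F P) (R : N2Rich M.d3) (hR : M.d2 = R.toDatum F P) :
    M.d2.AdmGenerating := by
  rw [hR]
  exact R.toDatum_admGenerating F P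

/-- The stronger sentence `AdmSpanning` from the construction binder. -/
theorem admSpanning_rich₃ (M : NAut3 F P) (R : N2Rich M.d3) (hR : M.d2 = R.toDatum F P) :
    M.d2.AdmSpanning := by
  rw [hR]
  exact R.toDatum_admSpanning F P

/-- The four EX binders of v6 (`N2Contract3.ExplicitShape M`) from the construction binder. -/
theorem explicitShape_rich₃ (M : NAut3 F P) (R : N2Rich M.d3) (hR : M.d2 = R.toDatum F P) :
    N2Contract3.ExplicitShape M := by
  unfold N2Contract3.ExplicitShape
  rw [hR]
  exact R.toDatum_explicitShape F P

/-- THE WHOLE N2 BLOCK OF v6 (`M.AdmDatum` and `hAdm`) from the one construction binder. -/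
theorem N2_block_rich₃ (M : NAut3 F P) (R : N2Rich M.d3) (hR : M.d2 = R.toDatum F P) :
    M.AdmDatum ∧ M.d2.AdmGenerating :=
  ⟨N2_main_rich₃ M R hR, admGenerating_rich₃ M R hR⟩

/-- The carrier's admissible quadruples are membership in the rich datum's four sets. -/
theorem admData_rich₃_iff (M : NAut3 F P) (R : N2Rich M.d3) (hR : M.d2 = R.toDatum F P)
    (φ : M.d3.A.Sa × M.d3.A.Sb × M.d3.B.Sa × M.d3.B.Sb) :
    M.AdmData φ ↔ φ.1 ∈ R.admA ∧ φ.2.1 ∈ R.admB ∧ φ.2.2.1 ∈ R.admC ∧ φ.2.2.2 ∈ R.admD := by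
  show M.d2.AdmData φ ↔ _
  rw [hR]
  exact Iff.rfl

/-- A v1 carrier with the constructed datum adjoined (the lead's `NAut3.ofNAut`) satisfies the
construction binder by `rfl` … -/
theorem ofNAut_toDatum_d2 (M₁ : NAut F P) (R : N2Rich M₁.d3) :
    (NAut3.ofNAut M₁ (R.toDatum F P)).d2 = R.toDatum F P := rfl

/-- … hence has N2's conclusion and N3's sentence with no hypothesis at all. -/
theorem ofNAut_toDatum_block (M₁ : NAut F P) (R : N2Rich M₁.d3) :
    (NAut3.ofNAut M₁ (R.toDatum F P)).AdmDatum ∧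
      (NAut3.ofNAut M₁ (R.toDatum F P)).d2.AdmGenerating :=
  N2_block_rich₃ _ R rfl

end N2Rich

end Summit.Ventures.HodgeRepro2.T6
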